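import Summits.BirchSwinnertonDyer.BirchSwinnertonDyer.Theses.PrintX10b
import Summits.BirchSwinnertonDyer.BirchSwinnertonDyer.Theorems.PrintX10bHowardRoad
import Literature.NumberTheory.EllipticCurves.IwasawaAlgebraProofs
import Literature.NumberTheory.EllipticCurves.CyclotomicIwasawaMainTheoremIrreducibleProofs
import Mathlib.RingTheory.UniqueFactorizationDomain.Multiplicity
import HarnessLib

/-!
# Line `mu-isolation-x10b` on crux stmt-BirchSwinnertonDyer-23729 `HowardContainmentAnyClassNumberX10b`
(route PrintX10b, r303 = A₃; registry crux decl
`Summit.BirchSwinnertonDyer.BirchSwinnertonDyer.Theses.PrintX10b.HowardContainmentAnyClassNumberX10b`;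
seat bsd-idea-16 g1, lens «decomp»; BSD is not proved by any of this).

DECOMPOSITION ALONG THE HEIGHT-ONE PRIMES OF `Λ = ℤ₃⟦T⟧` — `(3)` versus all the others — instead of the
twin line `torsion_depth_x10b`'s regime split by class number / torsion depth `δ` / parity of `d_K`.
Howard's integral containment `char_Λ(𝔖/ℋ_F)² ⊆ char_Λ(𝔛_{Λ-tors})` for the tree Heegner family `F` is
the conjunction of

* `stub_pLocalizedContainment` — the containment in `Λ[1/3]`: `∃ m, (3)^m · I(ℋ_F)² ⊆ char_Λ(𝔛_tors)`, on
  EVERY X10b non-CM Heegner frame (`d_K ∉ {-3,-4}`), ANY class number, ANY torsion depth, no corank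
  hypothesis. For odd `d_K` this is Castella–Grossi–Skinner 2025 Thm. 6.5.2 (printed for any `h_K`, for
  CGLS's `d(k)`-shifted class `κ^{Hg}`; the tree record `CastellaGrossiSkinner2025.thm652_…` carries the
  extra unprinted `p ∤ h_K`, TODO(general form) in that file) ∘ the module comparison
  `ℋ_F ⊆ Λκ_∞^{Hg}` (vertical distribution relations); for even `d_K ≠ -4` it is the same typed-print gap
  as the twin's `stub_depthPos_localized_evenDisc` ((disc) is where `𝓛_v^{BDP}` lives, not the Kolyvagin
  argument). No `T`-localisation: Thm. 6.5.2 has none.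
* `stub_muPart` — the `(3)`-primary part: `∀ k, char_Λ(𝔛_tors) ⊆ (3)^k → I(ℋ_F)² ⊆ (3)^k`, i.e.
  `μ(𝔛_tors) ≤ 2·μ(𝔖/ℋ_F)` (both ideals are principal; `mu_generator_eq_muInvariant`). THE ISOLATED
  BEYOND-PRINT CORE of the crux at `3 ∣ h_K`: every printed any-class-number Kolyvagin bound (CGLS 2022
  Thm. 3.4.1/4.1.3, CGS 2025 Thm. 6.5.2) inverts `p`; the integral ones (Howard 2004 Thm. B, Mastella–Zerman
  2026 Thm. 3.15/Cor. 4.6) build `κ` from `K[p^{k+1}] ⊇ K_k`, i.e. use `p ∤ h_K`. Mechanism on offer: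
  MZ26 Thm. 2.40 (abstract, `h_K`-free) over the specialisations `Λ/(3 + T^M)` of CGLS Thm. 4.1.1's
  any-class-number system + Howard 2004 §2.2 / Mazur–Rubin 5.3 control, `M → ∞`; or `μ(𝔛_tors) = 0`
  outright (`stub_muPart_of_muZero` below, kernel-checked sufficiency).

The PROMOTION from the two parts to the integral containment is pure commutative algebra and is PROVED
here (`le_of_augIdealP_saturation`: `Λ` is a UFD, `(3) = (C 3)` is a height-one prime, `char_Λ(𝔛_tors)`
is principal and nonzero; write its generator as `3^a·c'` with `3 ∤ c'`). The composition
`HowardContainmentAnyClassNumberX10b_of : stub_pLocalizedContainment → stub_muPart → crux` is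
sorry-free; the data `jbar, 𝔖, F, 𝔛` are produced in the kernel (`IsAlgClosed.lift`,
`nonempty_lambdaAdicSelmerData`, `nonempty_heegnerFamily_of`, `nonempty_selmerDualData`).
Statements are over the tree's canonical `HeegnerFamily` module `ℋ_F` (all `ℤ₃[G_k]`-translates of all
`z_j`, `j ≤ k`: choice-free), not over `∀ C : StabilizedHeegnerData` (whose `u_k, v_k` are pinned only
up to independent `Gal(K_k/K)`-translates — the junk-`C` hazard flagged by idea-crit-10 on the twin).
-/

set_option linter.dupNamespace false
set_option autoImplicit false

noncomputable section

open scoped Classical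

namespace Summit.BirchSwinnertonDyer.BirchSwinnertonDyer.Cruxes.HowardContainmentAnyClassNumberX10b.MuIsolationX10b

open WeierstrassCurve NumberField IsDedekindDomain Field Literature.NumberTheory.EllipticCurves
  Literature.NumberTheory.EllipticCurves.ModularForms
open Literature.NumberTheory.EllipticCurves.Rank1Residual (ClassX10 Surj)

/-! ## Stub statements as named propositions (binders = the crux's, letter for letter, then the data) -/

/-- **The containment in `Λ[1/3]` (all height-one primes `≠ (3)`), any class number, any torsion depth:**
`∃ m, (3)^m · char_Λ(𝔖/ℋ_F)² ⊆ char_Λ(𝔛_{Λ-tors})` for every `Λ`-adic Selmer datum, every tree Heegner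
family at level `N_E` and every Selmer-dual datum on a non-CM X10b Heegner frame with `d_K ∉ {-3,-4}`.
Odd `d_K`: CGS 2025 Thm. 6.5.2 (i)–(ii) (any `h_K`, no image / corank hypothesis, `E(K)[3] = 0` from (irr))
for `Λκ^{Hg}` ∘ `ℋ_F ⊆ Λκ^{Hg}` (distribution relations) — PRINT modulo typing the general form and the
module comparison; even `d_K ≠ -4`: outside (disc), typed-print gap (mechanism printed).
[cite: CastellaGrossiSkinner2025, Thm. 6.5.2 (arXiv:2303.04373, final TeX l.3231–3238)]
[cite: CastellaGrossiLeeSkinner2022, Thm. 4.1.1 and Rem. 4.1.4 (d(k)-shift, any h_K; arXiv:2008.02571)]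
[cite: PerrinRiou1987BSMF, §3.3 (distribution relations)] -/
def Stmt.stub_pLocalizedContainment : Prop :=
    ∀ (W : WeierstrassCurve ℚ) [W.IsElliptic] [W.IsGloballyMinimal] (p : ℕ) [Fact p.Prime]
      [NeZero (W.conductorNorm ℤ)] (K : Type) [Field K] [NumberField K],
      ClassX10 W p → ¬ Surj W 3 → ¬ W.HasCM →
      IsImaginaryQuadratic K → NumberField.discr K ≠ -3 → NumberField.discr K ≠ -4 →
      SatisfiesHeegnerHypothesis (W.conductorNorm ℤ) K → SatisfiesHeegnerHypothesis p K →
      ∀ (κ : ZpExtension K p), κ.IsAnticyclotomic → ∀ (γ : Field.absoluteGaloisGroup K),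
      κ.IsTopGenerator γ →
      ∀ (jbar : AlgebraicClosure K →+* ℂ) (D : (W.baseChange K).LambdaAdicSelmerData κ γ)
        (F : HeegnerFamily (W.conductorNorm ℤ) W K κ jbar) (X : (W.baseChange K).SelmerDualData κ γ),
      ∃ m : ℕ,
        IwasawaAlgebra.augIdealP p ^ m * heegnerCharIdeal D F ^ 2 ≤
          Module.charIdeal (IwasawaAlgebra p) (Submodule.torsion (IwasawaAlgebra p) X.X)

/-- **The `μ`-part (the height-one prime `(3)`):** `∀ k, char_Λ(𝔛_tors) ⊆ (3)^k → char_Λ(𝔖/ℋ_F)² ⊆ (3)^k`,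
i.e. `ord_{(3)} char_Λ(𝔛_tors) ≤ 2 · ord_{(3)} char_Λ(𝔖/ℋ_F)` — for torsion quotients `μ(𝔛_tors) ≤ 2 μ(𝔖/ℋ_F)`
(`mu_generator_eq_muInvariant`). At `3 ∤ h_K` a consequence of MZ26 Cor. 4.6; at `3 ∣ h_K` BEYOND PRINT:
the isolated core of the crux. Mechanism: MZ26 Thm. 2.40 over `𝓡_M = Λ/(3 + T^M)` applied to the
specialisations of CGLS Thm. 4.1.1's any-class-number Kolyvagin system (Howard 2004 §2.2 control), with
`length(N/(3+T^M)N) = M·μ(N) + O(1)`; sufficient: `μ(𝔛_tors) = 0` (`stub_muPart_of_muZero`).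
[cite: MastellaZerman2026, Thm. 2.40, Lemma 2.39, Thm. 3.15 (arXiv:2505.08710)]
[cite: CastellaGrossiLeeSkinner2022, Thm. 4.1.1 (arXiv:2008.02571)] [cite: Howard2004HeegnerKolyvagin, §2.2 and Thm. B] -/
def Stmt.stub_muPart : Prop :=
    ∀ (W : WeierstrassCurve ℚ) [W.IsElliptic] [W.IsGloballyMinimal] (p : ℕ) [Fact p.Prime]
      [NeZero (W.conductorNorm ℤ)] (K : Type) [Field K] [NumberField K],
      ClassX10 W p → ¬ Surj W 3 → ¬ W.HasCM →
      IsImaginaryQuadratic K → NumberField.discr K ≠ -3 → NumberField.discr K ≠ -4 →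
      SatisfiesHeegnerHypothesis (W.conductorNorm ℤ) K → SatisfiesHeegnerHypothesis p K →
      ∀ (κ : ZpExtension K p), κ.IsAnticyclotomic → ∀ (γ : Field.absoluteGaloisGroup K),
      κ.IsTopGenerator γ →
      ∀ (jbar : AlgebraicClosure K →+* ℂ) (D : (W.baseChange K).LambdaAdicSelmerData κ γ)
        (F : HeegnerFamily (W.conductorNorm ℤ) W K κ jbar) (X : (W.baseChange K).SelmerDualData κ γ)
        (k : ℕ),
      Module.charIdeal (IwasawaAlgebra p) (Submodule.torsion (IwasawaAlgebra p) X.X) ≤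
          IwasawaAlgebra.augIdealP p ^ k →
        heegnerCharIdeal D F ^ 2 ≤ IwasawaAlgebra.augIdealP p ^ k

/-! ## The stubs (the ONLY sorries of the file) -/

theorem stub_pLocalizedContainment : Stmt.stub_pLocalizedContainment := by
  sorry

theorem stub_muPart : Stmt.stub_muPart := by
  sorry

/-! ## The promotion: commutative algebra of `Λ = ℤ_p⟦T⟧`, PROVED -/

/-- **`(p)`-saturation in `Λ`.** If `C` is a nonzero principal ideal of `Λ = ℤ_p⟦T⟧`, `J` is any ideal,
`(p)^m · J ⊆ C` for some `m`, and `J ⊆ (p)^k` whenever `C ⊆ (p)^k`, then `J ⊆ C`: write a generator of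
`C` as `p^a c'` with `p ∤ c'` (`Λ` is Noetherian, `(p)` is prime — `isPrime_augIdealP_holds`), take
`k = a`, and cancel. [folklore] -/
theorem le_of_augIdealP_saturation {p : ℕ} [Fact p.Prime] {J C : Ideal (IwasawaAlgebra p)}
    (hC : C.IsPrincipal) (hC0 : C ≠ ⊥)
    (h1 : ∃ m : ℕ, IwasawaAlgebra.augIdealP p ^ m * J ≤ C)
    (h2 : ∀ k : ℕ, C ≤ IwasawaAlgebra.augIdealP p ^ k → J ≤ IwasawaAlgebra.augIdealP p ^ k) :
    J ≤ C := by
  haveI := hC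
  obtain ⟨c, hc⟩ := Submodule.IsPrincipal.principal C
  change C = Ideal.span {c} at hc
  set ϖ : IwasawaAlgebra p := PowerSeries.C (p : ℤ_[p]) with hϖdef
  have hp0 : (p : ℤ_[p]) ≠ 0 := Nat.cast_ne_zero.mpr (Fact.out : p.Prime).ne_zero
  have hϖ0 : ϖ ≠ 0 := by
    intro h
    apply hp0
    have h' := congrArg PowerSeries.constantCoeff h
    simpa [hϖdef] using h'
  have haug : IwasawaAlgebra.augIdealP p = Ideal.span {ϖ} := rfl
  have hϖP : Prime ϖ := (Ideal.span_singleton_prime hϖ0).mp (haug ▸ IwasawaAlgebra.isPrime_augIdealP_holds p)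
  have hpow : ∀ k : ℕ, IwasawaAlgebra.augIdealP p ^ k = Ideal.span {ϖ ^ k} := fun k ↦ by
    rw [haug, Ideal.span_singleton_pow]
  have hc0 : c ≠ 0 := by
    rintro rfl
    exact hC0 (by rw [hc, Ideal.span_singleton_eq_bot])
  obtain ⟨a, c', hndvd, hcfac⟩ := WfDvdMonoid.max_power_factor hc0 hϖP.irreducible
  have hJa : J ≤ Ideal.span {ϖ ^ a} := by
    rw [← hpow]
    apply h2
    rw [hpow, hc]
    exact Ideal.span_singleton_le_span_singleton.mpr ⟨c', hcfac⟩
  obtain ⟨m, hm⟩ := h1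
  intro j hj
  have h1j : c ∣ ϖ ^ m * j := by
    have hmem : ϖ ^ m * j ∈ C :=
      hm (Ideal.mul_mem_mul (by rw [hpow]; exact Ideal.mem_span_singleton_self _) hj)
    rw [hc] at hmem
    exact Ideal.mem_span_singleton.mp hmem
  obtain ⟨y, rfl⟩ : ϖ ^ a ∣ j := Ideal.mem_span_singleton.mp (hJa hj)
  rw [hcfac] at h1j
  have h2' : c' ∣ ϖ ^ m * y := by
    have : ϖ ^ a * c' ∣ ϖ ^ a * (ϖ ^ m * y) := by
      simpa [mul_comm, mul_left_comm, mul_assoc] using h1j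
    exact (mul_dvd_mul_iff_left (pow_ne_zero a hϖP.ne_zero)).mp this
  obtain ⟨x, hx⟩ := h2'
  have hxm : ϖ ^ m ∣ x := hϖP.pow_dvd_of_dvd_mul_left m hndvd ⟨y, by rw [← hx, mul_comm]⟩
  obtain ⟨x', rfl⟩ := hxm
  have hy : y = c' * x' := by
    have : ϖ ^ m * y = ϖ ^ m * (c' * x') := by rw [hx]; ring
    exact mul_left_cancel₀ (pow_ne_zero m hϖP.ne_zero) this
  subst hy
  rw [hc]
  exact Ideal.mem_span_singleton.mpr ⟨x', by rw [hcfac]; ring⟩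

/-! ## Composition (kernel-checked, no `sorry`) -/

/-- **The two parts give the crux BY NAME.** Realise `jbar := IsAlgClosed.lift` along `ιC` (as in
`X10.heegnerContainment_of_cor46_of_not_surj`), produce the data in the kernel, and promote by
`le_of_augIdealP_saturation` with `C = char_Λ(𝔛_tors)` (principal: `charIdeal_isPrincipal_holds`;
nonzero: `Module.charIdeal_ne_bot`) and `J = char_Λ(𝔖/ℋ_F)²`. -/
theorem HowardContainmentAnyClassNumberX10b_of
    (hA : Stmt.stub_pLocalizedContainment) (hB : Stmt.stub_muPart) :
    Summit.BirchSwinnertonDyer.BirchSwinnertonDyer.Theses.PrintX10b.HowardContainmentAnyClassNumberX10b := by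
  unfold Stmt.stub_pLocalizedContainment at hA
  unfold Stmt.stub_muPart at hB
  intro W _ _ p _ _ K _ _ hX hns hcm hK h3 h4 hHN hHp κ hκ γ hγ Dt H ιC
  letI : Algebra K ℂ := ιC.toAlgebra
  let jbar : AlgebraicClosure K →+* ℂ :=
    (IsAlgClosed.lift (R := K) (M := ℂ) (S := AlgebraicClosure K)).toRingHom
  obtain ⟨D⟩ := LambdaAdicSelmerDataExists.nonempty_lambdaAdicSelmerData (W.baseChange K) p κ hγ
  obtain ⟨X⟩ := (W.baseChange K).nonempty_selmerDualData_holds κ γ hγ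
  obtain ⟨F⟩ := nonempty_heegnerFamily_of (exists_isHeegnerNormPoint_holds (W.conductorNorm ℤ) W K p)
    hK hHN hX.not_dvd_conductorNorm κ Dt H.dvd_sq_sub jbar
  exact ⟨jbar, D, F, X,
    le_of_augIdealP_saturation (charIdeal_isPrincipal_holds p _)
      (Module.charIdeal_ne_bot (IwasawaAlgebra p) _)
      (hA W p K hX hns hcm hK h3 h4 hHN hHp κ hκ γ hγ jbar D F X)
      (hB W p K hX hns hcm hK h3 h4 hHN hHp κ hκ γ hγ jbar D F X)⟩

/-- The composed line from the two stubs (sorries only through `stub_*`). -/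
theorem HowardContainmentAnyClassNumberX10b_of_stubs :
    Summit.BirchSwinnertonDyer.BirchSwinnertonDyer.Theses.PrintX10b.HowardContainmentAnyClassNumberX10b :=
  HowardContainmentAnyClassNumberX10b_of stub_pLocalizedContainment stub_muPart

/-! ## Kernel evidence: the `μ = 0` road to the `μ`-part -/

/-- **`μ(𝔛_{Λ-tors}) = 0` on non-CM X10b Heegner frames** (a statement about the anticyclotomic Selmer
group ALONE — no Heegner module, no class number in its formulation): `char_Λ(𝔛_tors) ⊄ (3)`.
NOT a registered stub; a sufficient condition for `stub_muPart` (`stub_muPart_of_muZero`).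
[cite: MastellaZerman2026, Cor. 4.6 (gives μ(𝔛_tors) ≤ 2μ(𝔖/ℋ) at p ∤ h_K)] -/
def Stmt.muZero : Prop :=
    ∀ (W : WeierstrassCurve ℚ) [W.IsElliptic] [W.IsGloballyMinimal] (p : ℕ) [Fact p.Prime]
      [NeZero (W.conductorNorm ℤ)] (K : Type) [Field K] [NumberField K],
      ClassX10 W p → ¬ Surj W 3 → ¬ W.HasCM →
      IsImaginaryQuadratic K → NumberField.discr K ≠ -3 → NumberField.discr K ≠ -4 →
      SatisfiesHeegnerHypothesis (W.conductorNorm ℤ) K → SatisfiesHeegnerHypothesis p K →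
      ∀ (κ : ZpExtension K p), κ.IsAnticyclotomic → ∀ (γ : Field.absoluteGaloisGroup K),
      κ.IsTopGenerator γ → ∀ (X : (W.baseChange K).SelmerDualData κ γ),
      ¬ Module.charIdeal (IwasawaAlgebra p) (Submodule.torsion (IwasawaAlgebra p) X.X) ≤
          IwasawaAlgebra.augIdealP p

/-- `μ(𝔛_tors) = 0` implies the `μ`-part trivially (`k = 0`: everything is `⊆ ⊤`; `k ≥ 1`: the
hypothesis `char ⊆ (3)^k ⊆ (3)` is refuted). [folklore] -/
theorem stub_muPart_of_muZero (h0 : Stmt.muZero) : Stmt.stub_muPart := by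
  unfold Stmt.muZero at h0
  unfold Stmt.stub_muPart
  intro W _ _ p _ _ K _ _ hX hns hcm hK h3 h4 hHN hHp κ hκ γ hγ jbar D F X k hk
  cases k with
  | zero => simp
  | succ k =>
    exact absurd (hk.trans (Ideal.pow_le_self (Nat.succ_ne_zero k)))
      (h0 W p K hX hns hcm hK h3 h4 hHN hHp κ hκ γ hγ X)

end Summit.BirchSwinnertonDyer.BirchSwinnertonDyer.Cruxes.HowardContainmentAnyClassNumberX10b.MuIsolationX10b

end
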